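import Summits.FinalStateConjecture.FinalStateConjecture.Theorems.BulkKerrCapture.Negative.PointwiseVsUniform
import Summits.FinalStateConjecture.FinalStateConjecture.Theorems.NearExtremalKappaCapture.Negative.ExponentMonotonicity
import HarnessLib

/-!
# `BulkKerrCapture`, line `two-centre-lebesgue-cover`, Stub 2: the claim implies the faithful form
(uniformity on compact spin sets is a Lebesgue number)

Crux `stmt-FinalStateConjecture-10696`
(`Summit.FinalStateConjecture.FinalStateConjecture.Theses.PhaseMixingCapture.BulkKerrCapture`),
line lead `prover-line-stmt-FinalStateConjecture-10696-0`, skeleton v2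
(`Cruxes/BulkKerrCapture/Lines/two-centre-lebesgue-cover.lean`), registered stub
`stub_faithful_of_claim`, proved here verbatim.

**Statement.** HYPOTHESIS: the body of the Literature claim
`Literature.Geometry.Lorentzian.hintz_kerr_stability_subextremal_cauchy` (Hintz, arXiv:2606.28253,
Thm. 1.1 / Thm. 13.1 with Remarks 13.2–13.3, consequence form locally uniform in the centre): around
every normalised sub-extremal centre `χ₀ ∈ (−1, 1)` and normalised inner radius `ρ₀` between the
unit-mass horizons there are exponents `(s, δ, k)` and a spin radius `ς > 0`, and per mass `M > 0` and
tolerance `η > 0` ONE basin `ε > 0`, serving every spin `a` with `|a/M − χ₀| < ς` at `r₀ = ρ₀ M`.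
CONCLUSION: the FAITHFUL form of the crux — for every `a₁ < 1` one `(s, δ, k)` and, per `(M, η)`,
one `ε` serve EVERY spin `|a| ≤ a₁ M` at the crux's leaf `r₀ = M` (b-conormal data, qualitative
nearness `|M' − M| + |a' − a| ≤ η`, far-complete `𝓘⁺`, `Cᵏ`-convergence to a sub-extremal Kerr).

**Proof** (the idea card's lever, kernel-checked): for `a₁ < 0` the spin range is empty
(`Negative.no_spin_of_neg`). Otherwise the compact segment `K = [−a₁, a₁]` of normalised spins lies in
the OPEN interval `(−1, 1)` of admissible centres — the only use of the strict gap `a₁ < 1`, as the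
disprover's `Negative.bulkCaptureFamily_false_without_spinGap` demands — and `ρ₀ = 1` is admissible at
every centre (`1 ∈ (1 − √(1 − χ₀²), 1 + √(1 − χ₀²))`). Cover `K` by the spin balls `(χ₀ − ς, χ₀ + ς)`,
extract a finite subcover `t` (`IsCompact.elim_finite_subcover_image`), and take `max s`, `max δ`,
`min k` over `t` — independent of `(M, η)` — and, for each `(M, η)`, `min ε` over `t`. A spin
`|a| ≤ a₁ M` has `a/M ∈ K`, hence lies in the ball of some centre `χ₀ ∈ t`; the local body at `χ₀`
applies at `r₀ = M = 1 · M ∈ (r₋, r₊)` (`Negative.mem_Ioo_rMinus_rPlus`, `|a| < M`), its hypotheses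
following from the common ones by the `(s, δ)`-monotonicity of the data distance
(`NearExtremalKappaCapture.Negative.dataWeightedSobolevEDist_mono`: the b-conormality at the larger
`δ` gives it at `δ(χ₀)`, the `ε`-ball at `(max s, max δ)` lies in the `ε(χ₀)`-ball at
`(s(χ₀), δ(χ₀))` since `min ε ≤ ε(χ₀)`), and its `C^{k(χ₀)}` convergence gives `C^{min k}`
convergence (`Spacetime.ConvergesTo.of_le`).
-/

noncomputable section

open Set Filter Topology Function
open scoped Manifold ContDiff ENNReal Topology
open Literature.Geometry.Lorentzian
open Summit.FinalStateConjecture.FinalStateConjecture.Theorems.BulkKerrCapture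

namespace Summit.FinalStateConjecture.FinalStateConjecture.Theorems

/-- **Stub `stub_faithful_of_claim` of the line `two-centre-lebesgue-cover` (crux `BulkKerrCapture`):
the locally-uniform claim (Hintz 2026, Thm. 13.1 + Remark 13.2, consequence form) implies capture
with `(s, δ, k)` and, per mass and tolerance, `ε` UNIFORM on every compact spin set `|a| ≤ a₁ M`,
`a₁ < 1`, at the leaf `r₀ = M` — the Lebesgue number of a finite subcover of `[−a₁, a₁] ⊂ (−1, 1)`.
See the module docstring for the statement in words and the proof. [folklore] -/
theorem stub_faithful_of_claim :
    (∀ [Kerr.Facts] [Kerr.SliceFacts],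
      ∀ χ₀ : ℝ, |χ₀| < 1 → ∀ ρ₀ ∈ Set.Ioo (1 - √(1 - χ₀ ^ 2)) (1 + √(1 - χ₀ ^ 2)),
        ∃ (s : ℕ) (δ : ℝ) (k : ℕ), ∃ ς > (0 : ℝ), ∀ (M : ℝ) (hM : 0 < M), ∀ η > (0 : ℝ),
          ∃ ε > (0 : ℝ), ∀ a r₀ : ℝ, |a / M - χ₀| < ς → r₀ = ρ₀ * M →
            r₀ ∈ Set.Ioo (Kerr.rMinus M a) (Kerr.rPlus M a) →
            ∀ (D : InitialDataSet 𝓘(ℝ, E3) (Kerr.slice a r₀)) [D.metric.HasLeviCivita],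
              D.IsVacuumConstraintSolution →
              (∀ s' : ℕ,
                InitialDataSet.dataWeightedSobolevEDist s' δ D (Kerr.data M a r₀ hM.le) < ⊤) →
              InitialDataSet.dataWeightedSobolevEDist s δ D (Kerr.data M a r₀ hM.le) <
                ENNReal.ofReal ε →
              ∀ 𝒟 : VacuumCauchyDevelopment D, 𝒟.IsMaximal →
                ∃ (M' a' : ℝ) (𝒟oc : Set 𝒟.carrier), Kerr.IsSubextremal M' a' ∧
                  |M' - M| + |a' - a| ≤ η ∧
                  𝒟.HasCompleteFutureNullInfinityFar ∧
                  𝒟.toSpacetime.ConvergesToKerr 𝒟oc M' a' k) →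
    ∀ [Kerr.Facts] [Kerr.SliceFacts], ∀ a₁ : ℝ, a₁ < 1 → ∃ (s : ℕ) (δ : ℝ) (k : ℕ),
      ∀ (M : ℝ) (hM : 0 < M), ∀ η > (0 : ℝ), ∃ ε > (0 : ℝ), ∀ a : ℝ, |a| ≤ a₁ * M →
        ∀ (D : InitialDataSet 𝓘(ℝ, E3) (Kerr.slice a M)) [D.metric.HasLeviCivita],
          D.IsVacuumConstraintSolution →
          (∀ s' : ℕ,
            InitialDataSet.dataWeightedSobolevEDist s' δ D (Kerr.data M a M hM.le) < ⊤) →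
          InitialDataSet.dataWeightedSobolevEDist s δ D (Kerr.data M a M hM.le) <
            ENNReal.ofReal ε →
          ∀ 𝒟 : VacuumCauchyDevelopment D, 𝒟.IsMaximal →
            ∃ (M' a' : ℝ) (𝒟oc : Set 𝒟.carrier), Kerr.IsSubextremal M' a' ∧
              |M' - M| + |a' - a| ≤ η ∧
              𝒟.HasCompleteFutureNullInfinityFar ∧
              𝒟.toSpacetime.ConvergesToKerr 𝒟oc M' a' k := by
  intro hclaim instF instS a₁ ha₁
  classical
  -- empty spin range
  rcases lt_or_ge a₁ 0 with hneg | hnn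
  · exact ⟨0, 0, 0, fun M hM η _ ↦ ⟨1, one_pos, fun a ha ↦
      (Negative.no_spin_of_neg hneg hM ha).elim⟩⟩
  -- the compact segment of normalised spins lies in the open interval of admissible centres
  set K : Set ℝ := Icc (-a₁) a₁ with hK
  have hKc : IsCompact K := isCompact_Icc
  have hKsub : ∀ χ ∈ K, |χ| < 1 := fun χ hχ ↦ by
    rw [hK, mem_Icc] at hχ
    exact abs_lt.2 ⟨by linarith [hχ.1], by linarith [hχ.2]⟩
  -- the unit normalised inner radius is admissible at every sub-extremal centre
  have hρ : ∀ χ : ℝ, |χ| < 1 → (1 : ℝ) ∈ Set.Ioo (1 - √(1 - χ ^ 2)) (1 + √(1 - χ ^ 2)) := by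
    intro χ hχ
    have hpos : 0 < √(1 - χ ^ 2) := by
      apply Real.sqrt_pos.2
      have h1 : χ ^ 2 < 1 := by
        have := (sq_lt_one_iff_abs_lt_one χ).2 hχ
        exact this
      linarith
    exact ⟨by linarith, by linarith⟩
  -- local data of the claim at every centre of `K`, inner radius `ρ₀ = 1`
  choose! s δ k ς hς hcap using
    fun χ (hχ : χ ∈ K) ↦ hclaim χ (hKsub χ hχ) 1 (hρ χ (hKsub χ hχ))
  -- finite subcover of `K` by the spin balls
  have hcover : K ⊆ ⋃ χ ∈ K, Metric.ball χ (ς χ) := fun χ hχ ↦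
    mem_biUnion hχ (Metric.mem_ball_self (hς χ hχ))
  obtain ⟨t, htK, htfin, hsub⟩ :=
    hKc.elim_finite_subcover_image (fun χ _ ↦ Metric.isOpen_ball) hcover
  have hKne : K.Nonempty := ⟨0, by rw [hK, mem_Icc]; exact ⟨by linarith, hnn⟩⟩
  have htne : t.Nonempty := by
    obtain ⟨x, hx⟩ := hKne
    have hx' := hsub hx
    simp only [mem_iUnion] at hx'
    obtain ⟨i, hi, -⟩ := hx'
    exact ⟨i, hi⟩
  -- exponents uniform over the subcover (independent of the mass and the tolerance)
  obtain ⟨iS, -, hsmax⟩ := t.exists_max_image s htfin htne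
  obtain ⟨iD, -, hdmax⟩ := t.exists_max_image δ htfin htne
  obtain ⟨iK, -, hkmin⟩ := t.exists_min_image k htfin htne
  refine ⟨s iS, δ iD, k iK, fun M hM η hη ↦ ?_⟩
  -- per mass and tolerance: one basin over the subcover
  choose! ε hε hbody using fun χ (hχ : χ ∈ t) ↦ hcap χ (htK hχ) M hM η hη
  obtain ⟨iE, hiEt, hemin⟩ := t.exists_min_image ε htfin htne
  refine ⟨ε iE, hε iE hiEt, fun a ha D _ hvac hcon hdist 𝒟 hmax ↦ ?_⟩
  -- locate the normalised spin in the cover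
  have hχK : a / M ∈ K := by
    rw [hK, mem_Icc, ← abs_le, abs_div, abs_of_pos hM, div_le_iff₀ hM]
    exact ha
  have ha' := hsub hχK
  simp only [mem_iUnion] at ha'
  obtain ⟨χ₀, hχ₀t, hball⟩ := ha'
  have hnear : |a / M - χ₀| < ς χ₀ := by simpa [Metric.mem_ball, Real.dist_eq] using hball
  have halt : Kerr.IsSubextremal M a := Negative.isSubextremal_of_spin_le ha₁ hM ha
  -- the common hypotheses imply the local ones (monotonicity in `(s, δ)`)
  have hmono_con : ∀ s' : ℕ,
      InitialDataSet.dataWeightedSobolevEDist s' (δ χ₀) D (Kerr.data M a M hM.le) < ⊤ :=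
    fun s' ↦ lt_of_le_of_lt
      (NearExtremalKappaCapture.Negative.dataWeightedSobolevEDist_mono le_rfl (hdmax χ₀ hχ₀t) D
        (Kerr.data M a M hM.le)) (hcon s')
  have hmono_dist : InitialDataSet.dataWeightedSobolevEDist (s χ₀) (δ χ₀) D
      (Kerr.data M a M hM.le) < ENNReal.ofReal (ε χ₀) :=
    lt_of_le_of_lt
      (NearExtremalKappaCapture.Negative.dataWeightedSobolevEDist_mono (hsmax χ₀ hχ₀t)
        (hdmax χ₀ hχ₀t) D (Kerr.data M a M hM.le))
      (hdist.trans_le (ENNReal.ofReal_le_ofReal (hemin χ₀ hχ₀t)))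
  -- the local body at the centre `χ₀`, inner radius `M = 1 · M`
  obtain ⟨M', a', 𝒟oc, hsub', hpar, hfar, hconv⟩ :=
    hbody χ₀ hχ₀t a M hnear (by ring) (Negative.mem_Ioo_rMinus_rPlus halt) D hvac hmono_con
      hmono_dist 𝒟 hmax
  exact ⟨M', a', 𝒟oc, hsub', hpar, hfar, Spacetime.ConvergesTo.of_le hconv (hkmin χ₀ hχ₀t)⟩

end Summit.FinalStateConjecture.FinalStateConjecture.Theorems

end
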